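import Mathlib
import HarnessLib

/-!
# Real Gaussian integrals with a complex symmetric quadratic form: `(∫ e^{-xᵀAx/2 + xᵀMx})² · det(A − 2M) = (2π)ⁿ`

Topic `Analysis/SpecialFunctions` (next to `ComplexGaussianDeterminant.lean`, the Hermitian
positive-definite case over `ℂ^N`). Here: the REAL `n`-dimensional Gaussian `e^{-xᵀAx/2} dx`
(`A` real symmetric positive definite) tilted by a COMPLEX symmetric quadratic form `e^{xᵀMx}`
whose real part is dominated, `A − 2 Re M ≻ 0`. The classical formula
`∫_{ℝⁿ} e^{-xᵀAx/2 + xᵀMx} dx = (2π)^{n/2} det(A − 2M)^{-1/2}` involves a branch of the square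
root (fixed by analytic continuation from real `M`); we state and prove its BRANCH-FREE form

  `(∫_{ℝⁿ} e^{-xᵀAx/2 + xᵀMx} dx)² · det(A − 2M) = (2π)ⁿ`,

from which zero-freeness of the integral AND of `det(A − 2M)` follow at once, together with the
normalised form `(E e^{XᵀMX})² · det(1 − 2A⁻¹M) = 1` for `X ∼ N(0, A⁻¹)`.

This is the "complex covariance shift" / `det(1 − 2KC)^{-1/2}` step of every Gaussian
(spin-wave, Hubbard–Stratonovich) computation with complex couplings; e.g. it is the statement
that the spin-wave caricature of a complex two-current perturbation of a lattice Gaussian field is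
zero-free as long as twice the real part of the perturbation is dominated by the stiffness
(crux `Summit.HubbardSuperconductivity.HubbardSuperconductivity.Theses.NodalWardXY.PerturbedXYOrder`,
`Cruxes/PerturbedXYOrder/Disproof.lean` §5.3).

Proof (the textbook one, Hörmander *ALPDO I* Thm 7.6.1 / Zinn-Justin §1.1): write
`M = P + iQ` with `P, Q` real symmetric, `B := A − 2P ≻ 0`; choose a real invertible `T` with
`TᵀBT = 1` and `TᵀQT = diag(d)` (congruence diagonalisation: `B = CᵀC`, then the spectral theorem
for the symmetric `C⁻ᵀQC⁻¹`); substitute `x = Ty` (Jacobian `|det T|`); the integral factorises into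
`n` one-dimensional complex Gaussian integrals `∫ e^{-(1/2 − i d_k) y²} dy = (π/(1/2 − i d_k))^{1/2}`
(Mathlib `integral_cexp_neg_sum_mul_add`), while `det T² · det(B − 2iQ) = ∏ₖ (1 − 2i d_k)`; the
product of the two is `∏ₖ 2π`.

Mathlib has the diagonal case (`integral_cexp_neg_sum_mul_add`: `∫ e^{-Σ bᵢvᵢ² + Σ cᵢvᵢ}` for
`Re bᵢ > 0`) and the isotropic case (`GaussianFourier.integral_cexp_neg_mul_sq_norm_add`); the
general complex symmetric matrix case is not there at the pin.

## Contents
* `exists_transpose_mul_mul_eq_one_and_eq_diagonal` — congruence diagonalisation of a pair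
  (positive definite, symmetric) of real matrices;
* `integral_comp_mulVec_real` — `∫ f(Ty) dy = |det T|⁻¹ ∫ f`;
* `sq_integral_cexp_quadratic_mul_det` — the branch-free formula for `e^{-xᵀBx/2 + i xᵀQx}`;
* `sq_integral_cexp_quadratic_mul_det_of_symm` — the same for a complex symmetric `M`;
* `integral_cexp_quadratic_ne_zero`, `det_sub_two_smul_ne_zero` — zero-freeness.
-/

noncomputable section

namespace Literature.Analysis.SpecialFunctions

open MeasureTheory Matrix Complex
open scoped BigOperators ComplexOrder MatrixOrder Real

variable {ι : Type*} [Fintype ι] [DecidableEq ι]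

/-! ### Linear algebra: congruence diagonalisation of `(B ≻ 0, Q = Qᵀ)` -/

/-- A real positive definite matrix is `CᵀC` with `C` invertible. [folklore] -/
theorem exists_eq_transpose_mul_self_of_posDef {B : Matrix ι ι ℝ} (hB : B.PosDef) :
    ∃ C : Matrix ι ι ℝ, C.det ≠ 0 ∧ B = Cᵀ * C := by
  obtain ⟨C, hC⟩ := CStarAlgebra.nonneg_iff_eq_star_mul_self.mp hB.posSemidef.nonneg
  have hC' : B = Cᵀ * C := by
    rw [hC, Matrix.star_eq_conjTranspose, Matrix.conjTranspose_eq_transpose_of_trivial]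
  refine ⟨C, fun h => hB.det_pos.ne' ?_, hC'⟩
  rw [hC', Matrix.det_mul, h, mul_zero]

/-- **Congruence diagonalisation of a pair.** For a real positive definite `B` and a real symmetric
`Q` there is a real invertible `T` with `TᵀBT = 1` and `TᵀQT` diagonal (take `B = CᵀC` and
diagonalise the symmetric matrix `C⁻ᵀQC⁻¹` by an orthogonal `U`; `T = C⁻¹U`). [folklore] -/
theorem exists_transpose_mul_mul_eq_one_and_eq_diagonal {B Q : Matrix ι ι ℝ} (hB : B.PosDef)
    (hQ : Q.IsSymm) :
    ∃ T : Matrix ι ι ℝ, T.det ≠ 0 ∧ Tᵀ * B * T = 1 ∧ ∃ d : ι → ℝ, Tᵀ * Q * T = diagonal d := by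
  obtain ⟨C, hCdet, hBC⟩ := exists_eq_transpose_mul_self_of_posDef hB
  have hCunit : IsUnit C.det := Ne.isUnit hCdet
  have hCC : C * C⁻¹ = 1 := Matrix.mul_nonsing_inv C hCunit
  have hCC' : C⁻¹ * C = 1 := Matrix.nonsing_inv_mul C hCunit
  -- the symmetric matrix `S = C⁻ᵀ Q C⁻¹`
  set S : Matrix ι ι ℝ := (C⁻¹)ᵀ * Q * C⁻¹ with hS
  have hSh : S.IsHermitian := by
    rw [Matrix.IsHermitian, Matrix.conjTranspose_eq_transpose_of_trivial, hS,
      Matrix.transpose_mul, Matrix.transpose_mul, Matrix.transpose_transpose, hQ.eq, Matrix.mul_assoc]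
  set U : Matrix ι ι ℝ := (hSh.eigenvectorUnitary : Matrix ι ι ℝ) with hU
  have hUmem : U ∈ Matrix.unitaryGroup ι ℝ := hSh.eigenvectorUnitary.2
  have hU1 : star U * U = 1 := Matrix.mem_unitaryGroup_iff'.mp hUmem
  have hU2 : U * star U = 1 := Matrix.mem_unitaryGroup_iff.mp hUmem
  have hstarU : star U = Uᵀ := by
    rw [Matrix.star_eq_conjTranspose, Matrix.conjTranspose_eq_transpose_of_trivial]
  rw [hstarU] at hU1 hU2
  have hspec : S = U * diagonal hSh.eigenvalues * Uᵀ := by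
    have h := hSh.spectral_theorem
    rw [Unitary.conjStarAlgAut_apply] at h
    simpa [hstarU, ← hU] using h
  have hkey : Uᵀ * S * U = diagonal hSh.eigenvalues := by
    have h := congrArg (fun X => Uᵀ * X * U) hspec
    rw [h]
    calc Uᵀ * (U * diagonal hSh.eigenvalues * Uᵀ) * U
        = (Uᵀ * U) * diagonal hSh.eigenvalues * (Uᵀ * U) := by
          simp only [Matrix.mul_assoc]
      _ = diagonal hSh.eigenvalues := by rw [hU1, Matrix.one_mul, Matrix.mul_one]
  have hTinv : (C⁻¹ * U) * (Uᵀ * C) = 1 := by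
    calc (C⁻¹ * U) * (Uᵀ * C) = C⁻¹ * (U * Uᵀ) * C := by simp only [Matrix.mul_assoc]
      _ = 1 := by rw [hU2, Matrix.mul_one, hCC']
  refine ⟨C⁻¹ * U, ?_, ?_, hSh.eigenvalues, ?_⟩
  · intro h0
    have := congrArg Matrix.det hTinv
    rw [Matrix.det_mul, h0, zero_mul, Matrix.det_one] at this
    exact zero_ne_one this
  · -- `(C⁻¹U)ᵀ (CᵀC) (C⁻¹U) = Uᵀ (C C⁻¹)ᵀ (C C⁻¹) U = 1`
    rw [hBC, Matrix.transpose_mul]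
    calc Uᵀ * (C⁻¹)ᵀ * (Cᵀ * C) * (C⁻¹ * U)
        = Uᵀ * ((C * C⁻¹)ᵀ * (C * C⁻¹)) * U := by
          simp only [Matrix.transpose_mul, Matrix.mul_assoc]
      _ = 1 := by rw [hCC, Matrix.transpose_one, Matrix.one_mul, Matrix.mul_one, hU1]
  · rw [Matrix.transpose_mul]
    calc Uᵀ * (C⁻¹)ᵀ * Q * (C⁻¹ * U) = Uᵀ * S * U := by
          simp only [hS, Matrix.mul_assoc]
      _ = diagonal hSh.eigenvalues := hkey

/-! ### Measure theory: linear change of variables on `ℝ^ι`, quadratic forms under `x = Ty` -/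

omit [DecidableEq ι] in
/-- Transport of a quadratic form under `x = Ty`: `(Ty)ᵀM(Ty) = yᵀ(TᵀMT)y`. [folklore] -/
theorem dotProduct_mulVec_mulVec_eq (T M : Matrix ι ι ℝ) (y : ι → ℝ) :
    (T *ᵥ y) ⬝ᵥ (M *ᵥ (T *ᵥ y)) = y ⬝ᵥ ((Tᵀ * M * T) *ᵥ y) := by
  rw [Matrix.mulVec_mulVec, ← Matrix.vecMul_transpose, ← Matrix.dotProduct_mulVec,
    Matrix.mulVec_mulVec, Matrix.mul_assoc]

/-- **Linear change of variables on `ℝ^ι`** (complex-valued integrands): for an invertible real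
matrix `T`, `∫ f(Ty) dy = |det T|⁻¹ ∫ f(x) dx` (both sides vanish together when `f` is not
integrable). [folklore] -/
theorem integral_comp_mulVec_real (T : Matrix ι ι ℝ) (hT : T.det ≠ 0) (f : (ι → ℝ) → ℂ) :
    ∫ y, f (T *ᵥ y) = |T.det|⁻¹ • ∫ x, f x := by
  haveI : Invertible T := Matrix.invertibleOfIsUnitDet T (Ne.isUnit hT)
  let e : (ι → ℝ) ≃ᵐ (ι → ℝ) :=
    ((Matrix.toLinearEquiv' T ‹_›).toContinuousLinearEquiv).toHomeomorph.toMeasurableEquiv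
  have he : ∀ v, e v = T *ᵥ v := fun v => by
    change Matrix.toLin' T v = T *ᵥ v
    exact Matrix.toLin'_apply T v
  have hdet : LinearMap.det (Matrix.toLin' T) ≠ 0 := by rwa [LinearMap.det_toLin']
  have hmap : (volume : Measure (ι → ℝ)).map (fun v => T *ᵥ v) = ENNReal.ofReal |T.det⁻¹| • volume := by
    have h := Measure.map_linearMap_addHaar_eq_smul_addHaar (volume : Measure (ι → ℝ)) hdet
    rw [LinearMap.det_toLin'] at h
    have hcoe : (⇑(Matrix.toLin' T) : (ι → ℝ) → ι → ℝ) = fun v => T *ᵥ v := by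
      funext v; exact Matrix.toLin'_apply T v
    rwa [hcoe] at h
  calc ∫ y, f (T *ᵥ y) = ∫ y, f (e y) := by simp_rw [he]
    _ = ∫ x, f x ∂(volume.map e) := (integral_map_equiv e f).symm
    _ = |T.det|⁻¹ • ∫ x, f x := by
      rw [show (⇑e : (ι → ℝ) → ι → ℝ) = fun v => T *ᵥ v from funext he, hmap,
        integral_smul_measure, ENNReal.toReal_ofReal (abs_nonneg _), abs_inv]

/-! ### The branch-free Gaussian formula -/

/-- **Real Gaussian with an imaginary symmetric quadratic tilt, branch-free form.** For a real
positive definite `B` and a real symmetric `Q`,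
`(∫_{ℝⁿ} exp(−½ xᵀBx + i xᵀQx) dx)² · det(B − 2iQ) = (2π)ⁿ`.
(Classically `∫ = (2π)^{n/2} det(B − 2iQ)^{−1/2}` with the branch obtained by continuation from
`Q = 0`; squaring removes the branch.) [folklore] -/
theorem sq_integral_cexp_quadratic_mul_det {B Q : Matrix ι ι ℝ} (hB : B.PosDef) (hQ : Q.IsSymm) :
    (∫ x : ι → ℝ, cexp (-(1 / 2 : ℂ) * ((x ⬝ᵥ (B *ᵥ x) : ℝ) : ℂ) + I * ((x ⬝ᵥ (Q *ᵥ x) : ℝ) : ℂ))) ^ 2 *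
      (B.map Complex.ofReal - ((2 : ℂ) * I) • Q.map Complex.ofReal).det =
        (2 * (π : ℂ)) ^ Fintype.card ι := by
  obtain ⟨T, hTdet, hTB, d, hTQ⟩ := exists_transpose_mul_mul_eq_one_and_eq_diagonal hB hQ
  -- the integrand and its pull-back under `x = Ty`
  set g : (ι → ℝ) → ℂ := fun x =>
    cexp (-(1 / 2 : ℂ) * ((x ⬝ᵥ (B *ᵥ x) : ℝ) : ℂ) + I * ((x ⬝ᵥ (Q *ᵥ x) : ℝ) : ℂ)) with hg
  set b : ι → ℂ := fun i => 1 / 2 - I * (d i : ℂ) with hb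
  have hbre : ∀ i, 0 < (b i).re := fun i => by simp [hb]
  have hbne : ∀ i, b i ≠ 0 := fun i h => by simpa [h] using hbre i
  have hformB : ∀ y : ι → ℝ, (T *ᵥ y) ⬝ᵥ (B *ᵥ (T *ᵥ y)) = ∑ i, y i ^ 2 := fun y => by
    rw [dotProduct_mulVec_mulVec_eq, hTB, Matrix.one_mulVec]
    simp [dotProduct, pow_two]
  have hformQ : ∀ y : ι → ℝ, (T *ᵥ y) ⬝ᵥ (Q *ᵥ (T *ᵥ y)) = ∑ i, d i * y i ^ 2 := fun y => by
    rw [dotProduct_mulVec_mulVec_eq, hTQ]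
    simp only [dotProduct, Matrix.mulVec_diagonal]
    exact Finset.sum_congr rfl fun i _ => by ring
  have hexp : ∀ y : ι → ℝ,
      -(1 / 2 : ℂ) * (((T *ᵥ y) ⬝ᵥ (B *ᵥ (T *ᵥ y)) : ℝ) : ℂ) + I * (((T *ᵥ y) ⬝ᵥ (Q *ᵥ (T *ᵥ y)) : ℝ) : ℂ)
        = -∑ i, b i * ((y i : ℝ) : ℂ) ^ 2 + ∑ i, (0 : ℂ) * ((y i : ℝ) : ℂ) := fun y => by
    rw [hformB y, hformQ y]
    push_cast
    simp only [zero_mul, Finset.sum_const_zero, add_zero, Finset.mul_sum, ← Finset.sum_neg_distrib,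
      ← Finset.sum_add_distrib, hb]
    exact Finset.sum_congr rfl fun i _ => by ring
  -- the pulled-back integral factorises
  have hpull : ∫ y, g (T *ᵥ y) = ∏ i, ((π : ℂ) / b i) ^ (1 / 2 : ℂ) := by
    calc ∫ y, g (T *ᵥ y)
        = ∫ y : ι → ℝ, cexp (-∑ i, b i * ((y i : ℝ) : ℂ) ^ 2 + ∑ i, (0 : ℂ) * ((y i : ℝ) : ℂ)) := by
          refine integral_congr_ae (ae_of_all _ fun y => ?_)
          simp only [hg, hexp y]
      _ = ∏ i, ((π : ℂ) / b i) ^ (1 / 2 : ℂ) * cexp ((0 : ℂ) ^ 2 / (4 * b i)) :=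
          GaussianFourier.integral_cexp_neg_sum_mul_add hbre _
      _ = ∏ i, ((π : ℂ) / b i) ^ (1 / 2 : ℂ) := by simp
  -- change of variables: `∫ g = |det T| ∏ (π / bᵢ)^{1/2}`
  have hI : ∫ x, g x = ((|T.det| : ℝ) : ℂ) * ∏ i, ((π : ℂ) / b i) ^ (1 / 2 : ℂ) := by
    have hcv := integral_comp_mulVec_real T hTdet g
    rw [hpull] at hcv
    have habs : |T.det| ≠ 0 := abs_ne_zero.mpr hTdet
    have : ∫ x, g x = |T.det| • (|T.det|⁻¹ • ∫ x, g x) := by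
      rw [smul_smul, mul_inv_cancel₀ habs, one_smul]
    rw [this, ← hcv, Complex.real_smul]
  -- the determinant: `det T² · det(B − 2iQ) = ∏ (1 − 2 i dᵢ)`
  have hofReal : (Complex.ofReal : ℝ → ℂ) = ⇑Complex.ofRealHom := rfl
  have hTB' : (T.map Complex.ofReal)ᵀ * B.map Complex.ofReal * T.map Complex.ofReal = 1 := by
    rw [hofReal, ← Matrix.transpose_map, ← Matrix.map_mul, ← Matrix.map_mul, hTB,
      Matrix.map_one _ (map_zero _) (map_one _)]
  have hTQ' : (T.map Complex.ofReal)ᵀ * Q.map Complex.ofReal * T.map Complex.ofReal =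
      diagonal (fun i => (d i : ℂ)) := by
    rw [hofReal, ← Matrix.transpose_map, ← Matrix.map_mul, ← Matrix.map_mul, hTQ,
      Matrix.diagonal_map (map_zero _)]
  have hconj : (T.map Complex.ofReal)ᵀ * (B.map Complex.ofReal - ((2 : ℂ) * I) • Q.map Complex.ofReal) *
      T.map Complex.ofReal = diagonal (fun i => 1 - 2 * I * (d i : ℂ)) := by
    rw [Matrix.mul_sub, Matrix.sub_mul, Matrix.mul_smul, Matrix.smul_mul, hTB', hTQ']
    ext i j
    by_cases hij : i = j
    · subst hij; simp [mul_assoc]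
    · simp [hij]
  have hdetT : (T.map Complex.ofReal).det = (T.det : ℂ) := by
    rw [hofReal, ← RingHom.mapMatrix_apply, ← RingHom.map_det]
  have hdet : ((T.det : ℝ) : ℂ) ^ 2 * (B.map Complex.ofReal - ((2 : ℂ) * I) • Q.map Complex.ofReal).det =
      ∏ i, (1 - 2 * I * (d i : ℂ)) := by
    have h := congrArg Matrix.det hconj
    rw [Matrix.det_mul, Matrix.det_mul, Matrix.det_transpose, hdetT, Matrix.det_diagonal] at h
    rw [← h]; ring
  -- assemble
  have hdetT0 : ((T.det : ℝ) : ℂ) ≠ 0 := by exact_mod_cast hTdet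
  have hdet' : (B.map Complex.ofReal - ((2 : ℂ) * I) • Q.map Complex.ofReal).det =
      (∏ i, (1 - 2 * I * (d i : ℂ))) / ((T.det : ℝ) : ℂ) ^ 2 := by
    rw [← hdet, mul_div_cancel_left₀ _ (pow_ne_zero 2 hdetT0)]
  have habs2 : ((|T.det| : ℝ) : ℂ) ^ 2 = ((T.det : ℝ) : ℂ) ^ 2 := by
    rw [← Complex.ofReal_pow, ← Complex.ofReal_pow, sq_abs]
  have hsq : ∀ i, ((((π : ℂ) / b i) ^ (1 / 2 : ℂ)) ^ 2) = (π : ℂ) / b i := fun i => by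
    rw [← Complex.cpow_nat_mul]; norm_num
  change (∫ x, g x) ^ 2 * _ = _
  rw [hI, hdet', mul_pow, habs2, ← Finset.prod_pow]
  simp_rw [hsq]
  have key : ∀ A P R : ℂ, A ≠ 0 → A * P * (R / A) = P * R := fun A P R hA => by
    field_simp
  rw [key _ _ _ (pow_ne_zero 2 hdetT0), ← Finset.prod_mul_distrib]
  have hterm : ∀ i, (π : ℂ) / b i * (1 - 2 * I * (d i : ℂ)) = 2 * π := fun i => by
    have : (1 : ℂ) - 2 * I * (d i : ℂ) = 2 * b i := by simp only [hb]; ring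
    rw [this]; field_simp [hbne i]
  simp_rw [hterm]
  rw [Finset.prod_const, Finset.card_univ]

/-! ### Complex symmetric tilt `e^{xᵀMx}` of the Gaussian `e^{-xᵀAx/2}` -/

omit [Fintype ι] [DecidableEq ι] in
/-- Scalar bookkeeping: `a (z c) = a (Re z) c + i · a (Im z) c` for real `a, c`. [folklore] -/
theorem ofReal_mul_mul_ofReal_eq (a c : ℝ) (z : ℂ) :
    (a : ℂ) * (z * c) = (a : ℂ) * ((z.re : ℂ) * c) + I * ((a : ℂ) * ((z.im : ℂ) * c)) := by
  apply Complex.ext <;> simp [Complex.mul_re, Complex.mul_im]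

omit [DecidableEq ι] in
/-- For real `x` and complex `M`: `xᵀMx = xᵀ(Re M)x + i xᵀ(Im M)x`. [folklore] -/
theorem dotProduct_mulVec_ofReal_eq (M : Matrix ι ι ℂ) (x : ι → ℝ) :
    (fun i => (x i : ℂ)) ⬝ᵥ (M *ᵥ fun i => (x i : ℂ)) =
      ((x ⬝ᵥ (M.map Complex.re *ᵥ x) : ℝ) : ℂ) + I * ((x ⬝ᵥ (M.map Complex.im *ᵥ x) : ℝ) : ℂ) := by
  simp only [dotProduct, mulVec, Matrix.map_apply]
  push_cast
  simp only [Finset.mul_sum, ← Finset.sum_add_distrib]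
  refine Finset.sum_congr rfl fun i _ => Finset.sum_congr rfl fun j _ => ?_
  exact ofReal_mul_mul_ofReal_eq (x i) (x j) (M i j)

/-- **Real Gaussian with a complex symmetric quadratic tilt, branch-free form.** For a real matrix
`A` and a complex symmetric `M` with `A − 2 Re M` positive definite,
`(∫_{ℝⁿ} exp(−½ xᵀAx + xᵀMx) dx)² · det(A − 2M) = (2π)ⁿ`
(classically `∫ = (2π)^{n/2} det(A − 2M)^{−1/2}`, Hörmander *ALPDO I* Thm 7.6.1; squaring removes
the branch of the square root). [folklore] -/
theorem sq_integral_cexp_neg_half_add_quadratic_mul_det {A : Matrix ι ι ℝ} {M : Matrix ι ι ℂ}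
    (hM : M.IsSymm) (hAM : (A - (2 : ℝ) • M.map Complex.re).PosDef) :
    (∫ x : ι → ℝ, cexp (-(1 / 2 : ℂ) * ((x ⬝ᵥ (A *ᵥ x) : ℝ) : ℂ) +
        (fun i => (x i : ℂ)) ⬝ᵥ (M *ᵥ fun i => (x i : ℂ)))) ^ 2 *
      (A.map Complex.ofReal - (2 : ℂ) • M).det = (2 * (π : ℂ)) ^ Fintype.card ι := by
  set B : Matrix ι ι ℝ := A - (2 : ℝ) • M.map Complex.re with hB
  set Q : Matrix ι ι ℝ := M.map Complex.im with hQ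
  have hQs : Q.IsSymm := by
    show (M.map Complex.im)ᵀ = M.map Complex.im
    rw [← Matrix.transpose_map, hM.eq]
  have hint : ∀ x : ι → ℝ,
      -(1 / 2 : ℂ) * ((x ⬝ᵥ (A *ᵥ x) : ℝ) : ℂ) + (fun i => (x i : ℂ)) ⬝ᵥ (M *ᵥ fun i => (x i : ℂ)) =
        -(1 / 2 : ℂ) * ((x ⬝ᵥ (B *ᵥ x) : ℝ) : ℂ) + I * ((x ⬝ᵥ (Q *ᵥ x) : ℝ) : ℂ) := fun x => by
    rw [dotProduct_mulVec_ofReal_eq, ← hQ, hB, Matrix.sub_mulVec, dotProduct_sub, Matrix.smul_mulVec,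
      dotProduct_smul, smul_eq_mul]
    simp only [Complex.ofReal_sub, Complex.ofReal_mul, Complex.ofReal_ofNat]
    ring
  have hmat : A.map Complex.ofReal - (2 : ℂ) • M =
      B.map Complex.ofReal - ((2 : ℂ) * I) • Q.map Complex.ofReal := by
    ext i j
    simp only [hB, hQ, Matrix.sub_apply, Matrix.smul_apply, Matrix.map_apply, smul_eq_mul,
      Complex.ofReal_sub, Complex.ofReal_mul, Complex.ofReal_ofNat]
    apply Complex.ext <;> simp
  simp_rw [hint]
  rw [hmat]
  exact sq_integral_cexp_quadratic_mul_det hAM hQs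

/-- **Zero-freeness.** Under the same hypotheses the tilted Gaussian integral does not vanish and
`det(A − 2M) ≠ 0` ("the complex Gaussian integral never vanishes while twice the real part of the
tilt is dominated"). [folklore] -/
theorem integral_cexp_neg_half_add_quadratic_ne_zero {A : Matrix ι ι ℝ} {M : Matrix ι ι ℂ}
    (hM : M.IsSymm) (hAM : (A - (2 : ℝ) • M.map Complex.re).PosDef) :
    (∫ x : ι → ℝ, cexp (-(1 / 2 : ℂ) * ((x ⬝ᵥ (A *ᵥ x) : ℝ) : ℂ) +
        (fun i => (x i : ℂ)) ⬝ᵥ (M *ᵥ fun i => (x i : ℂ)))) ≠ 0 ∧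
      (A.map Complex.ofReal - (2 : ℂ) • M).det ≠ 0 := by
  have h := sq_integral_cexp_neg_half_add_quadratic_mul_det hM hAM
  have hne : (2 * (π : ℂ)) ^ Fintype.card ι ≠ 0 :=
    pow_ne_zero _ (mul_ne_zero two_ne_zero (Complex.ofReal_ne_zero.mpr Real.pi_pos.ne'))
  rw [← h] at hne
  exact ⟨fun h0 => hne (by rw [h0]; ring), fun h0 => hne (by rw [h0, mul_zero])⟩

/-- The unperturbed Gaussian: `(∫ e^{-xᵀAx/2})² · det A = (2π)ⁿ` (the case `M = 0`). [folklore] -/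
theorem sq_integral_cexp_neg_half_mul_det {A : Matrix ι ι ℝ} (hA : A.PosDef) :
    (∫ x : ι → ℝ, cexp (-(1 / 2 : ℂ) * ((x ⬝ᵥ (A *ᵥ x) : ℝ) : ℂ))) ^ 2 * (A.map Complex.ofReal).det =
      (2 * (π : ℂ)) ^ Fintype.card ι := by
  have h0 : ((0 : Matrix ι ι ℂ)).IsSymm := Matrix.isSymm_zero
  have hA' : (A - (2 : ℝ) • (0 : Matrix ι ι ℂ).map Complex.re).PosDef := by
    simpa using hA
  have h := sq_integral_cexp_neg_half_add_quadratic_mul_det h0 hA'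
  simpa using h

/-- **Normalised (probabilistic) form**: for `X ∼ N(0, A⁻¹)` and a complex symmetric `M` with
`A − 2 Re M ≻ 0`, `(E e^{XᵀMX})² · det(1 − 2A⁻¹M) = 1`, written with the two Gaussian integrals
(`E e^{XᵀMX} = ∫ e^{-xᵀAx/2 + xᵀMx} / ∫ e^{-xᵀAx/2}`). This is the `det(1 − 2KC)^{-1/2}` rule of
Gaussian perturbation theory in its branch-free form. [folklore] -/
theorem sq_div_integral_mul_det_one_sub {A : Matrix ι ι ℝ} {M : Matrix ι ι ℂ} (hA : A.PosDef)
    (hM : M.IsSymm) (hAM : (A - (2 : ℝ) • M.map Complex.re).PosDef) :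
    ((∫ x : ι → ℝ, cexp (-(1 / 2 : ℂ) * ((x ⬝ᵥ (A *ᵥ x) : ℝ) : ℂ) +
          (fun i => (x i : ℂ)) ⬝ᵥ (M *ᵥ fun i => (x i : ℂ)))) /
        (∫ x : ι → ℝ, cexp (-(1 / 2 : ℂ) * ((x ⬝ᵥ (A *ᵥ x) : ℝ) : ℂ)))) ^ 2 *
      (1 - (2 : ℂ) • ((A.map Complex.ofReal)⁻¹ * M)).det = 1 := by
  set P : ℂ := ∫ x : ι → ℝ, cexp (-(1 / 2 : ℂ) * ((x ⬝ᵥ (A *ᵥ x) : ℝ) : ℂ) +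
    (fun i => (x i : ℂ)) ⬝ᵥ (M *ᵥ fun i => (x i : ℂ))) with hP
  set P₀ : ℂ := ∫ x : ι → ℝ, cexp (-(1 / 2 : ℂ) * ((x ⬝ᵥ (A *ᵥ x) : ℝ) : ℂ)) with hP₀
  set A' : Matrix ι ι ℂ := A.map Complex.ofReal with hA'
  have h1 : P ^ 2 * (A' - (2 : ℂ) • M).det = (2 * (π : ℂ)) ^ Fintype.card ι :=
    sq_integral_cexp_neg_half_add_quadratic_mul_det hM hAM
  have h2 : P₀ ^ 2 * A'.det = (2 * (π : ℂ)) ^ Fintype.card ι := sq_integral_cexp_neg_half_mul_det hA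
  have hc : (2 * (π : ℂ)) ^ Fintype.card ι ≠ 0 :=
    pow_ne_zero _ (mul_ne_zero two_ne_zero (Complex.ofReal_ne_zero.mpr Real.pi_pos.ne'))
  have hdetA : A'.det ≠ 0 := fun h => hc (by rw [← h2, h, mul_zero])
  have hP₀ne : P₀ ≠ 0 := fun h => hc (by rw [← h2, h]; ring)
  have hdetA' : IsUnit A'.det := Ne.isUnit hdetA
  -- `1 − 2A'⁻¹M = A'⁻¹ (A' − 2M)`
  have hfac : (1 : Matrix ι ι ℂ) - (2 : ℂ) • (A'⁻¹ * M) = A'⁻¹ * (A' - (2 : ℂ) • M) := by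
    rw [Matrix.mul_sub, Matrix.nonsing_inv_mul _ hdetA', Matrix.mul_smul]
  rw [hfac, Matrix.det_mul, Matrix.det_nonsing_inv, Ring.inverse_eq_inv']
  have : P ^ 2 * (A' - (2 : ℂ) • M).det = P₀ ^ 2 * A'.det := by rw [h1, h2]
  field_simp
  linear_combination this

end Literature.Analysis.SpecialFunctions

end
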